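import Summits.ResolutionOfSingularities.ResolutionOfSingularities.Theorems.HomologicalConductorNoZenoRProperBirationalFiniteFibres
import Summits.ResolutionOfSingularities.ResolutionOfSingularities.Theorems.HomologicalConductorNoZenoRPullbackPairFinite
import Literature.AlgebraicGeometry.Resolution.GraphClosureCompactification
import Literature.AlgebraicGeometry.Resolution.RationalSurfaceSingularitiesBasic
import Literature.AlgebraicGeometry.Resolution.EmbeddedCurvePointBlowups
import Literature.AlgebraicGeometry.Resolution.BlowupsProperProofs
import Literature.AlgebraicGeometry.Resolution.BlowupsIntegral
import Literature.AlgebraicGeometry.Resolution.Blowups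
import HarnessLib

/-!
# Crux `NoZenoR` (stmt-ResolutionOfSingularities-19943) — RIGIDITY of the point blow-up: a morphism that contracts the
# exceptional curve descends to the blown-down surface (half (D1) of the one-blow-up descent (D))

Route `ResolutionOfSingularities/HomologicalConductor` (cell decomp-res, hand leafhand-res-homologicalconduct-16 g3).
OURS: AI-written proof over tree theorems, weaker than expert review; nothing here is a statement of the manuscript
under review (Hironaka 2017).  SUPPORT level, counted 0.  Def-free, no new named facts.

* `exists_fac_of_forall_base_eq` — **(D1)**: `τ : Z' → Z₁` a blowing up of a closed point `z₁` (`dim 𝒪_{Z₁,z₁} = 2`) of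
  a desingularization `g₁ : Z₁ → Spec S`, `π_r : X_r → Spec S` a desingularization, `h : Z' → X_r` an `S`-morphism
  CONSTANT on the exceptional fibre `τ⁻¹(z₁)`; then `h = τ ≫ h₁` for an `S`-morphism `h₁ : Z₁ → X_r`.  Proof (Zariski):
  the closure `Y'` of the graph of `h ∘ τ⁻¹` on `U = Z₁ ∖ {z₁}` inside `Z₁ ×_S X_r` (tree
  `GraphClosureCompactification`: integral, an isomorphism over `U`) lies in the image of the proper graph
  `(τ, h) : Z' → Z₁ ×_S X_r`, so its points over `z₁` lie over the pair `(z₁, x₀)` — a finite set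
  (`finite_setOf_fst_eq_snd_eq_of_isClosed`); hence `Y' → Z₁` is proper birational with finite fibres onto the regular
  `Z₁`, an isomorphism (`isIso_of_isProper_of_isBirational_of_finite_preimage_of_isRegular`), and
  `h₁ = (Y' → Z₁)⁻¹ ≫ (Y' → X_r)`; `τ ≫ h₁ = h` because both graphs agree on the dense open `τ⁻¹(U)` of the reduced `Z'`
  and `Z₁ ×_S X_r → Z₁` is separated.

No crux or summit statement is proved here.
-/

noncomputable section

-- single-problem summit: the doubled namespace component `ResolutionOfSingularities` is forced
set_option linter.dupNamespace false

open CategoryTheory CategoryTheory.Limits AlgebraicGeometry TopologicalSpace Topology IsLocalRing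
open Literature.AlgebraicGeometry.Resolution Scheme.IdealSheafData

universe u

namespace Summit.ResolutionOfSingularities.ResolutionOfSingularities.Theorems.NoZeno.ExcCount.FirstKind

/-- A point with two-dimensional local ring is not the only point of the scheme (its `coheight`, the dimension of the
local ring, would be `0`). [folklore] -/
theorem singleton_ne_univ_of_ringKrullDim_eq_two {Y : Scheme.{u}} {y : Y}
    (hy2 : ringKrullDim (Y.presheaf.stalk y) = 2) : ({y} : Set Y) ≠ Set.univ := by
  intro h
  have hmax : IsMax y := fun z _ => by
    have hz : z ∈ ({y} : Set Y) := h ▸ Set.mem_univ z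
    rw [Set.mem_singleton_iff] at hz
    exact le_of_eq hz
  have h0 : ringKrullDim (Y.presheaf.stalk y) = 0 := by
    rw [ringKrullDim_stalk_eq_coheight y, Order.coheight_eq_zero.mpr hmax]
    exact WithBot.coe_zero
  rw [hy2] at h0
  exact absurd h0 (by decide)

variable {S : Type u} [CommRing S] [IsNoetherianRing S] [IsDomain S]

/-- **(D1) RIGIDITY OF THE POINT BLOW-UP.**  Let `S` be a Noetherian domain, `g₁ : Z₁ → Spec S` and `π_r : X_r → Spec S`
desingularizations, `τ : Z' → Z₁` a blowing up of a closed point `z₁` with `dim 𝒪_{Z₁,z₁} = 2`, and `h : Z' → X_r` an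
`S`-morphism (`h ≫ π_r = τ ≫ g₁`) which is CONSTANT on the exceptional fibre: `h e = x₀` whenever `τ e = z₁`.  Then `h`
descends: there is `h₁ : Z₁ → X_r` with `τ ≫ h₁ = h` and `h₁ ≫ π_r = g₁`.
[cite: StacksProject, Tag 0C5J]; [cite: Liu2002, Thm. 9.2.2 (proof)] -/
theorem exists_fac_of_forall_base_eq {Z₁ Z' Xr : Scheme.{u}} (g₁ : Z₁ ⟶ Spec (.of S))
    (hg₁ : IsResolution g₁) (τ : Z' ⟶ Z₁) {z₁ : Z₁} (hz₁ : IsClosed ({z₁} : Set Z₁))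
    (hz2 : ringKrullDim (Z₁.presheaf.stalk z₁) = 2) (hτ : IsBlowup τ (vanishingIdeal ⟨{z₁}, hz₁⟩))
    (πr : Xr ⟶ Spec (.of S)) (hπr : IsResolution πr) (h : Z' ⟶ Xr) (hh : h ≫ πr = τ ≫ g₁)
    {x₀ : Xr} (hcontr : ∀ e : Z', τ.base e = z₁ → h.base e = x₀) :
    ∃ h₁ : Z₁ ⟶ Xr, τ ≫ h₁ = h ∧ h₁ ≫ πr = g₁ := by
  classical
  -- bookkeeping
  haveI : IsIntegral Z₁ := hg₁.isIntegral_source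
  haveI : IsIntegral Xr := hπr.isIntegral_source
  haveI : IsProper g₁ := hg₁.isProper
  haveI : IsProper πr := hπr.isProper
  haveI : IsLocallyNoetherian Z₁ := LocallyOfFiniteType.isLocallyNoetherian g₁
  haveI : IsNoetherian Z₁ := by
    haveI : CompactSpace Z₁ := QuasiCompact.compactSpace_of_compactSpace g₁
    exact {}
  set J : Z₁.IdealSheafData := vanishingIdeal ⟨{z₁}, hz₁⟩ with hJdef
  have hyne : ({z₁} : Set Z₁) ≠ Set.univ := singleton_ne_univ_of_ringKrullDim_eq_two hz2
  have hJ : J ≠ ⊥ := vanishingIdeal_singleton_ne_bot hz₁ hyne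
  haveI : IsIntegral Z' := hτ.isIntegral hJ
  haveI : IsProper τ := hτ.isProper
  have hJsupp : (J.support : Set Z₁) = {z₁} := coe_support_vanishingIdeal _
  -- the open `U = Z₁ ∖ {z₁}` and the isomorphism `τ⁻¹(U) ≅ U`
  let U : Z₁.Opens := ⟨(J.support : Set Z₁)ᶜ, J.support.isClosed.isOpen_compl⟩
  have hUmem : ∀ z : Z₁, z ∈ U ↔ z ≠ z₁ := fun z => by
    change z ∈ (J.support : Set Z₁)ᶜ ↔ _
    rw [hJsupp]; rfl
  have hUne0 : ((U : Z₁.Opens) : Set Z₁).Nonempty := by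
    by_contra hU
    rw [Set.not_nonempty_iff_eq_empty] at hU
    apply hyne
    ext z
    simp only [Set.mem_singleton_iff, Set.mem_univ, iff_true]
    by_contra hz
    have : z ∈ (U : Set Z₁) := (hUmem z).mpr hz
    rw [hU] at this
    exact this
  haveI : Nonempty (U : Scheme.{u}) := by
    obtain ⟨z, hz⟩ := hUne0
    exact ⟨(⟨z, hz⟩ : U)⟩
  haveI : IsIntegral (U : Scheme.{u}) := isIntegral_of_isOpenImmersion U.ι
  haveI hτU : IsIso (τ ∣_ U) := hτ.isIso_compl
  -- the ambient fibre product and the two graphs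
  let P := pullback g₁ πr
  let Γ : Z' ⟶ P := pullback.lift τ h hh.symm
  have hΓfst : Γ ≫ pullback.fst g₁ πr = τ := pullback.lift_fst _ _ _
  have hΓsnd : Γ ≫ pullback.snd g₁ πr = h := pullback.lift_snd _ _ _
  haveI : IsProper (Γ ≫ pullback.fst g₁ πr) := by rw [hΓfst]; infer_instance
  haveI : IsProper Γ := IsProper.of_comp Γ (pullback.fst g₁ πr)
  let γ₀ : (U : Scheme.{u}) ⟶ Z' := inv (τ ∣_ U) ≫ (τ ⁻¹ᵁ U).ι
  have hγ₀τ : γ₀ ≫ τ = U.ι := by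
    change (inv (τ ∣_ U) ≫ (τ ⁻¹ᵁ U).ι) ≫ τ = U.ι
    rw [Category.assoc, ← morphismRestrict_ι, IsIso.inv_hom_id_assoc]
  let γ : (U : Scheme.{u}) ⟶ P := γ₀ ≫ Γ
  have hγ : γ ≫ pullback.fst g₁ πr = U.ι := by
    change (γ₀ ≫ Γ) ≫ _ = _
    rw [Category.assoc, hΓfst, hγ₀τ]
  haveI : NoetherianSpace (U : Scheme.{u}) :=
    (noetherianSpace_set_iff _).mpr fun s _ => NoetherianSpace.isCompact s
  haveI : QuasiCompact γ := inferInstance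
  -- the closure `Y'` of the graph of `h ∘ τ⁻¹` on `U`
  let Y' : Scheme.{u} := γ.image
  let c : Y' ⟶ P := γ.imageι
  let q : Y' ⟶ Z₁ := c ≫ pullback.fst g₁ πr
  haveI : IsIntegral Y' := ChowLemmaProof.isIntegral_image γ
  obtain ⟨hqU, hqdense⟩ :=
    GraphClosureCompactification.isIso_morphismRestrict_opensRange U.ι (pullback.fst g₁ πr) γ hγ
  have hsq : γ.toImage ≫ q = U.ι := GraphClosureCompactification.toImage_comp U.ι (pullback.fst g₁ πr) γ hγ
  -- `q` is birational
  have hUne : ((U.ι.opensRange : Z₁.Opens) : Set Z₁).Nonempty := by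
    rw [Scheme.Hom.coe_opensRange, Scheme.Opens.range_ι]
    exact hUne0
  have hbir : IsBirational q :=
    ⟨U.ι.opensRange, U.ι.opensRange.isOpen.dense hUne, hqdense, hqU⟩
  -- the points of `Y'` lie in the image of the proper graph `Γ`
  have hrange : Set.range c.base ⊆ Set.range Γ.base := by
    have hc : Set.range c.base = closure (Set.range γ.base) := by
      have h1 := Scheme.IdealSheafData.range_subschemeι γ.ker
      rw [Scheme.Hom.support_ker] at h1
      exact h1
    rw [hc]
    refine closure_minimal ?_ Γ.isClosedMap.isClosed_range
    rintro _ ⟨v, rfl⟩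
    exact ⟨γ₀.base v, (Scheme.Hom.comp_apply γ₀ Γ v).symm⟩
  -- a point `e₀` of the exceptional fibre; `x₀ = h e₀` is a closed point and `g₁ z₁ = π_r x₀`
  haveI : IsDominant τ := (hτ.isBirational' hJ).isDominant
  have hτsurj : Function.Surjective τ.base := by
    rw [← Set.range_eq_univ, ← τ.isClosedMap.isClosed_range.closure_eq]
    exact τ.denseRange.closure_range
  obtain ⟨e₀, he₀⟩ := hτsurj z₁
  have hbase : g₁.base z₁ = πr.base x₀ := by
    have := congrArg (fun φ : Z' ⟶ Spec (.of S) => φ.base e₀) hh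
    simp only [Scheme.Hom.comp_base, TopCat.comp_app] at this
    rw [hcontr e₀ he₀, he₀] at this
    exact this.symm
  have hx₀ : IsClosed ({x₀} : Set Xr) := by
    have himg : h.base '' (τ.base ⁻¹' {z₁}) = {x₀} := by
      apply Set.eq_singleton_iff_unique_mem.mpr
      exact ⟨⟨e₀, he₀, hcontr e₀ he₀⟩, fun x ⟨e, he, hex⟩ => hex ▸ hcontr e he⟩
    haveI : IsProper (h ≫ πr) := by rw [hh]; infer_instance
    haveI : IsProper h := IsProper.of_comp h πr
    rw [← himg]
    exact h.isClosedMap _ (hz₁.preimage τ.base.hom.continuous)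
  -- hence `q` has finite fibres
  have hqc : ∀ t : Y', q.base t = (pullback.fst g₁ πr).base (c.base t) := fun t => rfl
  have hfin : ∀ y : Z₁, (q.base ⁻¹' {y}).Finite := by
    intro y
    by_cases hy : y = z₁
    · subst hy
      -- the fibre over `z₁` embeds (by the closed immersion `c`) into the points of `P` over `(z₁, x₀)`
      have hF := finite_setOf_fst_eq_snd_eq_of_isClosed g₁ πr y hx₀ hbase
      refine Set.Finite.of_finite_image (hF.subset ?_) (c.isClosedEmbedding.injective.injOn)
      rintro _ ⟨t, ht, rfl⟩
      have ht' : (pullback.fst g₁ πr).base (c.base t) = y := ht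
      refine ⟨ht', ?_⟩
      obtain ⟨e, he⟩ := hrange ⟨t, rfl⟩
      have hτe : τ.base e = y := by
        rw [← hΓfst, Scheme.Hom.comp_base, TopCat.comp_app, he]; exact ht'
      rw [← he, ← hcontr e hτe, ← hΓsnd, Scheme.Hom.comp_base, TopCat.comp_app]
    · -- off `z₁`, `q` is injective (an isomorphism over `U`)
      refine Set.Subsingleton.finite fun t₁ ht₁ t₂ ht₂ => ?_
      have hyU : y ∈ U.ι.opensRange := by
        rw [← SetLike.mem_coe, Scheme.Hom.coe_opensRange, Scheme.Opens.range_ι]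
        exact (hUmem y).mpr hy
      have h₁ : t₁ ∈ q ⁻¹ᵁ U.ι.opensRange := by
        change q.base t₁ ∈ U.ι.opensRange; rw [show q.base t₁ = y from ht₁]; exact hyU
      have h₂ : t₂ ∈ q ⁻¹ᵁ U.ι.opensRange := by
        change q.base t₂ ∈ U.ι.opensRange; rw [show q.base t₂ = y from ht₂]; exact hyU
      have hinj := (Scheme.homeoOfIso (asIso (q ∣_ U.ι.opensRange))).injective
      have hval : ∀ x : (q ⁻¹ᵁ U.ι.opensRange : Y'.Opens),
          ((q ∣_ U.ι.opensRange).base x).1 = q.base x.1 := fun x =>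
        morphismRestrict_base_coe q _ x
      have key : (⟨t₁, h₁⟩ : (q ⁻¹ᵁ U.ι.opensRange : Y'.Opens)) = ⟨t₂, h₂⟩ := by
        apply hinj
        apply Subtype.ext
        change ((q ∣_ U.ι.opensRange).base ⟨t₁, h₁⟩).1 = ((q ∣_ U.ι.opensRange).base ⟨t₂, h₂⟩).1
        rw [hval, hval]
        change q.base t₁ = q.base t₂
        rw [show q.base t₁ = y from ht₁, show q.base t₂ = y from ht₂]
      exact congrArg Subtype.val key
  -- so `q` is an isomorphism (Zariski's Main Theorem onto the regular `Z₁`)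
  haveI hq : IsIso q :=
    isIso_of_isProper_of_isBirational_of_finite_preimage_of_isRegular q hbir hg₁.isRegular hfin
  -- the descended morphism
  refine ⟨inv q ≫ c ≫ pullback.snd g₁ πr, ?_, ?_⟩
  · -- `τ ≫ h₁ = h`: the two graphs `Z' → P` agree on the dense open `τ⁻¹(U)` of the reduced `Z'`
    have hUne' : ((τ ⁻¹ᵁ U : Z'.Opens) : Set Z').Nonempty := by
      obtain ⟨z, hz⟩ := hUne
      rw [Scheme.Hom.coe_opensRange, Scheme.Opens.range_ι] at hz
      obtain ⟨e, rfl⟩ := hτsurj z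
      exact ⟨e, hz⟩
    haveI : IsDominant (τ ⁻¹ᵁ U).ι :=
      AlgebraicGeometry.Opens.isDominant_ι ((τ ⁻¹ᵁ U).isOpen.dense hUne')
    have htoImage : γ.toImage = U.ι ≫ inv q := (IsIso.eq_comp_inv q).mpr hsq
    have heq : τ ≫ inv q ≫ c = Γ := by
      refine ext_of_isDominant_of_isSeparated (pullback.fst g₁ πr) ?_ (τ ⁻¹ᵁ U).ι ?_
      · rw [Category.assoc, Category.assoc, IsIso.inv_hom_id, Category.comp_id, hΓfst]
      · rw [← Category.assoc, ← morphismRestrict_ι, Category.assoc, ← Category.assoc U.ι, ← htoImage,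
          Scheme.Hom.toImage_imageι]
        change (τ ∣_ U) ≫ (inv (τ ∣_ U) ≫ (τ ⁻¹ᵁ U).ι) ≫ Γ = _
        rw [Category.assoc, IsIso.hom_inv_id_assoc]
    rw [← Category.assoc, ← Category.assoc, Category.assoc τ, heq, hΓsnd]
  · rw [Category.assoc, Category.assoc, ← pullback.condition, ← Category.assoc c, IsIso.inv_hom_id_assoc]

end Summit.ResolutionOfSingularities.ResolutionOfSingularities.Theorems.NoZeno.ExcCount.FirstKind

end
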